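/-
Copyright (c) 2026. All rights reserved.
Released under Apache 2.0 license as described in the file LICENSE.
Authors: abc-iut cell, wave-4 seat abc-iut-w4-d059 (proof-only; T54-B «stabBranchPairAug-ASSEMBLY» at any chart).
-/
import Literature.AnabelianGeometry.SemiGraphs.ArithThm54CapstonesChart
import Literature.AnabelianGeometry.SemiGraphs.ArithBranchPairAugCosetTower
import HarnessLib

/-!
# [SemiAnbd] Thm 5.4 (i) p. 66: the (AI4″) binder `stabBranchPairAug` PRODUCED at the coset tower of the chart
# `D.chart` of ANY cofinal Galois tower `D` (proof-only; row T54-B, «T54·stabBranchPairAug-ASSEMBLY»)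

Mochizuki, *Semi-graphs of anabelioids*, Publ. RIMS **42** (2006), §5, proof of Thm 5.4 (i) p. 66 ("entirely
parallel" to Thm 3.7 (iii) p. 41) [cite: MochizukiSemiAnbd2006, Thm 5.4 (i) p.66].

PROOF-ONLY (abc-iut cell, row T54-B, seat abc-iut-w4-d059).  Twin of `ArithBranchPairAugCosetTower.lean` (canonical
tower) for the chart `D.chart h𝒢 hcof hcn hS hfin hne` of an ARBITRARY cofinal Galois tower `D` — the currency of
abc-iut-w4-d029's capstones v3 `arithMaximalCompactStatementI/II_outerAction_piPresentation_chart` and of the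
theorem of record at abc-iut-w4-d048's characteristic tower: `stabBranchPairAug_chart` (any compatible `E`) and
`stabBranchPairAug_chart_outerAction` (outer model).  `map_aug_le_conj_of_levelDict'` is instantiated as in the
canonical file, inputs bound BY NAME (the chart-generic dictionaries `ArithVertGpNormalizerDictionary` /
`ArithBrGpBranchClassDictionary`; `hsep` from `piPresentation_hfree`/`piPresentation_hMK`; abc-iut-w4-d053's
`range_decompHom_mem_verticialSubgroups_chart` / `piPresentation_M_mem_edgeLikeSubgroups_chart`), EXCEPT: the
estrangement consequence is the capstone's own binder `hnobpNCpt` (bound in the capstone chain by abc-iut-w4-d053's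
producer ∘ (I0v)), and `hfaith` is RE-DERIVED from it at any chart (`eq_one_of_mem_arithVertGp_of_trivial_levels`,
abc-iut-w6-d072's argument).  RESIDUAL binders (honest): `haugc`, `hLopen`, `hVc`, arithmetic cofinality `hAcof`,
`Π_A` compact Hausdorff, `hRcV`/`hRcB` (representatives matched to the presentation), `hnobpNCpt`.
No definition, no new named fact; typed ≠ proved for the residual; no side taken on [IUTchIII] Cor. 3.12.
-/

namespace Literature.AnabelianGeometry.SemiGraphs

open CategoryTheory Topology
open Literature.AnabelianGeometry.EtaleTheta
open scoped Pointwise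

universe u v

namespace ProfiniteSemiGraph

variable {𝒢 : ProfiniteSemiGraph.{u}}

section Faithful

variable (c : TemperedPiChart 𝒢) (P : SemiGraph.SubgroupPresentation 𝒢.graph c.G)
  {E : Type v} [Group E] {Φ : E →* MulAut c.G} {σ : E →* Aut 𝒢.graph} (hP : P.IsArithCompatible Φ σ)
  (ι : c.G →* E) (hι : Function.Injective ι)
  (hιconj : ∀ (e : E) (x : c.G), e * ι x * e⁻¹ = ι (Φ e x))
  (hιΦ : ∀ g : c.G, Φ (ι g) = MulAut.conj g) (hισ : ∀ g : c.G, σ (ι g) = 1)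
  (hPH : ∀ w, P.H w ∈ verticialSubgroups c w)
  (Rc : ChartRepresentatives c) (hRcV : ∀ v, Rc.Hv v = P.H v)
  (L : ℕ → Subgroup c.G) [∀ j, (L j).Normal] (hL : ∀ ⦃i j : ℕ⦄, i ≤ j → L j ≤ L i)
  (hLst : ∀ (j : ℕ) (e : E) (x : c.G), x ∈ L j → Φ e x ∈ L j)

include hP hι hιconj hιΦ hισ hPH hRcV hL in
/-- **`hfaith` at any chart**: a geometric element (`aug v = 1`) of `Π^temp_{𝔊,v₀}` acting trivially on EVERY
finite coset level is `1`: it is `ι g`, `g ∈ H_{v₀}` (self-normalisation), and `g` lies in the compact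
`H_{v₀} ∩ ⋂_n ker (arithAct_n ∘ ι)`, which fixes the given branch pair, so is trivial by `hnobp`
(abc-iut-w6-d072's route). [cite: MochizukiSemiAnbd2006, Thm 5.4 (i) p.66] -/
theorem eq_one_of_mem_arithVertGp_of_trivial_levels (h37 : 𝒢.Thm37Hypotheses)
    (hLopen' : ∀ n, IsOpen ((L n : Subgroup c.G) : Set c.G))
    (hnobp : ∀ (C : Subgroup c.G), IsCompact (C : Set c.G) →
      ∀ (j₀ : ℕ) (w : ∀ i : {i : ℕ // j₀ ≤ i}, (P.cosetGraph (L i.1)).Vertex)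
      (β β' : ∀ i : {i : ℕ // j₀ ≤ i}, (P.cosetGraph (L i.1)).Branch),
      (∀ i, β i ≠ β' i ∧ (P.cosetGraph (L i.1)).abuts (β i) = some (w i) ∧
        (P.cosetGraph (L i.1)).abuts (β' i) = some (w i)) →
      (∀ ⦃i i' : {i : ℕ // j₀ ≤ i}⦄ (h : i.1 ≤ i'.1), (P.cosetGraphTrans (hL h)).vertexMap (w i') = w i ∧
        (P.cosetGraphTrans (hL h)).branchMap (β i') = β i ∧
          (P.cosetGraphTrans (hL h)).branchMap (β' i') = β' i) →
      (∀ (i : {i : ℕ // j₀ ≤ i}) (γ : C), (P.arithAct hP (L i.1) (hLst i.1) (ι γ)).hom.vertexMap (w i) = w i ∧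
        (P.arithAct hP (L i.1) (hLst i.1) (ι γ)).hom.branchMap (β i) = β i ∧
          (P.arithAct hP (L i.1) (hLst i.1) (ι γ)).hom.branchMap (β' i) = β' i) → C = ⊥)
    {PA : Type*} [Group PA] (aug : E →* PA) (haug : aug.ker = ι.range)
    (j₀ : ℕ) (w : ∀ i : {i : ℕ // j₀ ≤ i}, (P.cosetGraph (L i.1)).Vertex)
    (β β' : ∀ i : {i : ℕ // j₀ ≤ i}, (P.cosetGraph (L i.1)).Branch)
    (hpair : ∀ i, β i ≠ β' i ∧ (P.cosetGraph (L i.1)).abuts (β i) = some (w i) ∧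
      (P.cosetGraph (L i.1)).abuts (β' i) = some (w i))
    (hcompat : ∀ ⦃i i' : {i : ℕ // j₀ ≤ i}⦄ (h : i.1 ≤ i'.1), (P.cosetGraphTrans (hL h)).vertexMap (w i') = w i ∧
      (P.cosetGraphTrans (hL h)).branchMap (β i') = β i ∧ (P.cosetGraphTrans (hL h)).branchMap (β' i') = β' i)
    {v₀ : 𝒢.graph.Vertex} :
    ∀ v ∈ (decompositionDataOfChart Rc ι).vertGp v₀, (∀ n, P.arithAct hP (L n) (hLst n) v = 1) → aug v = 1 → v = 1 := by
  intro v hv htriv hav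
  have hvr : v ∈ ι.range := by rw [← haug]; exact hav
  obtain ⟨g, rfl⟩ := hvr
  -- `g ∈ H_{v₀}`: `ι g` normalises `H_{v₀}` through `Φ (ι g) = conj g`; self-normalisation
  obtain ⟨-, hV⟩ := sigma_fix_and_isVConj_one_of_mem_arithVertGp c P hP ι hι hιconj hPH Rc hRcV h37 hv
  have hgH : g ∈ P.H v₀ := by
    refine hP.selfNormalizing v₀ g fun x => ?_
    have h := hV (g⁻¹ * x * g)
    rw [hιΦ, hισ, SemiGraph.aut_one_vertexMap, inv_one, one_mul, mul_one, MulAut.conj_apply,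
      show g * (g⁻¹ * x * g) * g⁻¹ = x by group] at h
    exact h.symm
  -- the compact subgroup `H_{v₀} ∩ ⋂_n ker (arithAct_n ∘ ι)` fixes every branch pair, so is trivial
  let N : ℕ → Subgroup c.G := fun n => ((P.arithAct hP (L n) (hLst n)).comp ι).ker
  have hLN : ∀ n, L n ≤ N n := fun n x hx => by
    rw [MonoidHom.mem_ker, MonoidHom.comp_apply]
    exact P.arithAct_eq_one_of_inner_mem hP (L n) (hLst n) (hιΦ x) (hισ x) hx
  have hNcl : ∀ n, IsClosed ((N n : Subgroup c.G) : Set c.G) := fun n =>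
    Subgroup.isClosed_of_isOpen _ (Subgroup.isOpen_mono (hLN n) (hLopen' n))
  have hCc : IsCompact (((P.H v₀ ⊓ ⨅ n, N n : Subgroup c.G)) : Set c.G) := by
    rw [Subgroup.coe_inf, Subgroup.coe_iInf]
    exact (isCompact_of_mem_verticialSubgroups c (hPH v₀)).inter_right (isClosed_iInter hNcl)
  have hCbot : (P.H v₀ ⊓ ⨅ n, N n : Subgroup c.G) = ⊥ := by
    refine hnobp _ hCc j₀ w β β' hpair hcompat fun i γ => ?_
    have hγ : (γ : c.G) ∈ N i.1 := (Subgroup.mem_iInf.mp (Subgroup.mem_inf.mp γ.2).2) i.1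
    have h1 : P.arithAct hP (L i.1) (hLst i.1) (ι γ) = 1 := by
      rw [MonoidHom.mem_ker, MonoidHom.comp_apply] at hγ
      exact hγ
    rw [h1]
    exact ⟨rfl, rfl, rfl⟩
  have hgC : g ∈ (P.H v₀ ⊓ ⨅ n, N n : Subgroup c.G) :=
    Subgroup.mem_inf.mpr ⟨hgH, Subgroup.mem_iInf.mpr fun n => by
      rw [MonoidHom.mem_ker, MonoidHom.comp_apply]
      exact htriv n⟩
  rw [hCbot] at hgC
  rw [(Subgroup.mem_bot).mp hgC, map_one]

end Faithful

section Chart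

variable (D : GaloisLevelData 𝒢) (h𝒢 : 𝒢.IsCountable)
  (hcof : ∀ (T : CovObj 𝒢), T.IsTempered → ∀ p : T.Point,
    ∃ i : ℕ, ∀ j, i ≤ j → (D.S j).Splits (T.component p))
  (hcn : 𝒢.graph.IsConnected) (hS : ∀ n, (D.S n).Splits (D.S n)) (hfin : ∀ n, (D.S n).IsFinite)
  (hne : ∀ n, (D.S n).HasNonemptyFibres)
  (hconn : ∀ (n : ℕ) (p q : (D.S n).Point), (D.S n).SameComponent p q)

/-- **`stabBranchPairAug` PRODUCED at the coset tower of `D.chart` for ANY cofinal Galois tower `D` and any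
compatible arithmetic group `E`** (binder text of `arithMaximalCompactStatementI_outerAction_piPresentation_chart`
at `P := D.piPresentation T R`, `L n := ker (D.piLevelAut n)`), modulo `hnobpNCpt` (the capstone's binder, with
`ι γ`) and the residual binders `haugc`/`hLopen`/`hVc`/`hAcof`/`hRcV`/`hRcB`. [cite: MochizukiSemiAnbd2006, Thm 5.4 (i) p.66] -/
theorem stabBranchPairAug_chart (h37 : 𝒢.Thm37Hypotheses) [Finite 𝒢.graph.Vertex] [Finite 𝒢.graph.Branch]
    (T : ∀ w : 𝒢.graph.Vertex, D.PointSeq h𝒢 w)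
    (R : SemiGraph.RefBranches 𝒢.graph) {E : Type u} [Group E] [TopologicalSpace E] [IsTopologicalGroup E]
    {Φ : E →* MulAut (D.chart h𝒢 hcof hcn hS hfin hne).G} {σ : E →* Aut 𝒢.graph}
    (hP : (D.piPresentation h𝒢 T R).IsArithCompatible Φ σ)
    (hN : ∀ (n : ℕ) (e : E) (x : (D.chart h𝒢 hcof hcn hS hfin hne).G),
      x ∈ (D.piLevelAut h𝒢 hconn n).ker →
        Φ e x ∈ (D.piLevelAut h𝒢 hconn n).ker)
    (ι : (D.chart h𝒢 hcof hcn hS hfin hne).G →* E) (hι : Function.Injective ι)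
    (hιΦ : ∀ g, Φ (ι g) = MulAut.conj g) (hισ : ∀ g, σ (ι g) = 1)
    (hιconj : ∀ (e : E) (x : (D.chart h𝒢 hcof hcn hS hfin hne).G), e * ι x * e⁻¹ = ι (Φ e x))
    (hΦc : ∀ e : E, Continuous (Φ e))
    {PA : Type u} [Group PA] [TopologicalSpace PA] [IsTopologicalGroup PA] [CompactSpace PA] [T2Space PA]
    (aug : E →* PA) (haugc : Continuous aug) (haug : aug.ker = ι.range)
    (Rc : ChartRepresentatives (D.chart h𝒢 hcof hcn hS hfin hne))
    (hRcV : ∀ v, Rc.Hv v = (D.piPresentation h𝒢 T R).H v)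
    (hRcB : ∀ b, Rc.Hb b = ((D.piPresentation h𝒢 T R).M (𝒢.graph.edgeOf b)).map
      (MulAut.conj ((D.piPresentation h𝒢 T R).s b)).toMonoidHom)
    (hLopen : ∀ n, IsOpen (((D.piPresentation h𝒢 T R).arithAct hP
      (D.piLevelAut h𝒢 hconn n).ker (hN n)).ker : Set E))
    (hVc : ∀ v, IsCompact (((decompositionDataOfChart Rc ι).vertGp v : Subgroup E) : Set E))
    (hAcof : ∀ U ∈ 𝓝 (1 : PA), ∃ j : ℕ, ∀ e ∈ ((D.piPresentation h𝒢 T R).arithAct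
      hP (D.piLevelAut h𝒢 hconn j).ker (hN j)).ker, aug e ∈ U)
    (hnobpNCpt : ∀ (C : Subgroup (D.chart h𝒢 hcof hcn hS hfin hne).G),
      IsCompact (C : Set (D.chart h𝒢 hcof hcn hS hfin hne).G) →
      ∀ (j₀ : ℕ) (w : ∀ i : {i : ℕ // j₀ ≤ i}, ((D.piPresentation h𝒢 T R).cosetGraph (D.piLevelAut h𝒢 hconn i.1).ker).Vertex)
      (β β' : ∀ i : {i : ℕ // j₀ ≤ i}, ((D.piPresentation h𝒢 T R).cosetGraph (D.piLevelAut h𝒢 hconn i.1).ker).Branch),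
      (∀ i, β i ≠ β' i ∧ ((D.piPresentation h𝒢 T R).cosetGraph (D.piLevelAut h𝒢 hconn i.1).ker).abuts (β i) = some (w i) ∧
        ((D.piPresentation h𝒢 T R).cosetGraph (D.piLevelAut h𝒢 hconn i.1).ker).abuts (β' i) = some (w i)) →
      (∀ ⦃i i' : {i : ℕ // j₀ ≤ i}⦄ (h : i.1 ≤ i'.1),
        ((D.piPresentation h𝒢 T R).cosetGraphTrans (D.ker_piLevelAut_anti h𝒢 hconn h)).vertexMap (w i') = w i ∧
        ((D.piPresentation h𝒢 T R).cosetGraphTrans (D.ker_piLevelAut_anti h𝒢 hconn h)).branchMap (β i') = β i ∧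
          ((D.piPresentation h𝒢 T R).cosetGraphTrans (D.ker_piLevelAut_anti h𝒢 hconn h)).branchMap (β' i') = β' i) →
      (∀ (i : {i : ℕ // j₀ ≤ i}) (γ : C),
        ((D.piPresentation h𝒢 T R).arithAct hP (D.piLevelAut h𝒢 hconn i.1).ker (hN i.1) (ι γ)).hom.vertexMap (w i) = w i ∧
        ((D.piPresentation h𝒢 T R).arithAct hP (D.piLevelAut h𝒢 hconn i.1).ker (hN i.1) (ι γ)).hom.branchMap (β i) = β i ∧
          ((D.piPresentation h𝒢 T R).arithAct hP (D.piLevelAut h𝒢 hconn i.1).ker (hN i.1) (ι γ)).hom.branchMap (β' i) = β' i) →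
        C = ⊥) :
    ∀ (C : Subgroup E), IsCompact (C : Set E) →
      ∀ (j₀ : ℕ) (w : ∀ i : {i : ℕ // j₀ ≤ i},
        ((D.piPresentation h𝒢 T R).cosetGraph
          (D.piLevelAut h𝒢 hconn i.1).ker).Vertex)
      (β β' : ∀ i : {i : ℕ // j₀ ≤ i},
        ((D.piPresentation h𝒢 T R).cosetGraph
          (D.piLevelAut h𝒢 hconn i.1).ker).Branch),
      (∀ i, β i ≠ β' i ∧
        ((D.piPresentation h𝒢 T R).cosetGraph
          (D.piLevelAut h𝒢 hconn i.1).ker).abuts (β i) = some (w i) ∧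
        ((D.piPresentation h𝒢 T R).cosetGraph
          (D.piLevelAut h𝒢 hconn i.1).ker).abuts (β' i) = some (w i)) →
      (∀ ⦃i i' : {i : ℕ // j₀ ≤ i}⦄ (h : i.1 ≤ i'.1),
        ((D.piPresentation h𝒢 T R).cosetGraphTrans
            (D.ker_piLevelAut_anti h𝒢 hconn h)).vertexMap (w i') = w i ∧
        ((D.piPresentation h𝒢 T R).cosetGraphTrans
            (D.ker_piLevelAut_anti h𝒢 hconn h)).branchMap (β i') = β i ∧
        ((D.piPresentation h𝒢 T R).cosetGraphTrans
            (D.ker_piLevelAut_anti h𝒢 hconn h)).branchMap (β' i') = β' i) →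
      (∀ (i : {i : ℕ // j₀ ≤ i}) (g : E), g ∈ C →
        ((D.piPresentation h𝒢 T R).arithAct hP
            (D.piLevelAut h𝒢 hconn i.1).ker (hN i.1) g).hom.vertexMap
            (w i) = w i ∧
        ((D.piPresentation h𝒢 T R).arithAct hP
            (D.piLevelAut h𝒢 hconn i.1).ker (hN i.1) g).hom.branchMap
            (β i) = β i ∧
        ((D.piPresentation h𝒢 T R).arithAct hP
            (D.piLevelAut h𝒢 hconn i.1).ker (hN i.1) g).hom.branchMap
            (β' i) = β' i) →
      ∃ (v : 𝒢.graph.Vertex) (b b' : 𝒢.graph.Branch) (a : PA) (h : E),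
        (decompositionDataOfChart Rc ι).abut b = some v ∧ (decompositionDataOfChart Rc ι).abut b' = some v ∧
        h ∈ (decompositionDataOfChart Rc ι).vertGp v ∧ (b' ≠ b ∨ h ∉ (decompositionDataOfChart Rc ι).brGp b) ∧
        C.map aug ≤ conjSubgroup a (((decompositionDataOfChart Rc ι).brGp b ⊓
          conjSubgroup h ((decompositionDataOfChart Rc ι).brGp b')).map aug) := by
  intro C _hCc j₀ w β β' hpair hcompat hC
  haveI hLn : ∀ j : ℕ, @Subgroup.Normal (D.chart h𝒢 hcof hcn hS hfin hne).G (D.chart h𝒢 hcof hcn hS hfin hne).group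
      ((D.piLevelAut h𝒢 hconn j).ker) := fun _ => MonoidHom.normal_ker _
  haveI hfinQ : ∀ j : ℕ, Finite ((D.chart h𝒢 hcof hcn hS hfin hne).G ⧸
      (D.piLevelAut h𝒢 hconn j).ker) := fun j =>
    D.finite_quotient_ker_piLevelAut h𝒢 hconn hfin j
  haveI : ∀ j : ℕ, Finite ((D.piPresentation h𝒢 T R).cosetGraph
      (D.piLevelAut h𝒢 hconn j).ker).Vertex := fun j =>
    (D.piPresentation h𝒢 T R).finite_cosetGraph_vertex _
  haveI : ∀ j : ℕ, Finite ((D.piPresentation h𝒢 T R).cosetGraph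
      (D.piLevelAut h𝒢 hconn j).ker).Branch := fun j =>
    (D.piPresentation h𝒢 T R).finite_cosetGraph_branch _
  have hPH : ∀ w', (D.piPresentation h𝒢 T R).H w' ∈
      verticialSubgroups (D.chart h𝒢 hcof hcn hS hfin hne) w' := fun w' => by
    rw [D.piPresentation_H h𝒢 T R]
    exact (T w').range_decompHom_mem_verticialSubgroups_chart hcof hcn hS hfin hne
  have hPM : ∀ ε, (D.piPresentation h𝒢 T R).M ε ∈
      edgeLikeSubgroups (D.chart h𝒢 hcof hcn hS hfin hne) ε := fun ε =>
    piPresentation_M_mem_edgeLikeSubgroups_chart D h𝒢 hcof hcn hS hfin hne T R ε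
  refine map_aug_le_conj_of_levelDict'
    (fun j => (D.piPresentation h𝒢 T R).cosetGraph
      (D.piLevelAut h𝒢 hconn j).ker)
    (fun j => (D.piPresentation h𝒢 T R).arithAct hP
      (D.piLevelAut h𝒢 hconn j).ker (hN j))
    (fun i j h => (D.piPresentation h𝒢 T R).cosetGraphTrans
      (D.ker_piLevelAut_anti h𝒢 hconn h))
    aug haugc hLopen
    (fun i j h => (D.piPresentation h𝒢 T R).ker_arithAct_anti hP (hN j)
      (hN i) (D.ker_piLevelAut_anti h𝒢 hconn h))
    (fun i j h e => (D.piPresentation h𝒢 T R).arithAct_trans hP (hN j) (hN i)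
      (D.ker_piLevelAut_anti h𝒢 hconn h) e)
    (fun j => (D.piPresentation h𝒢 T R).cosetGraphProj
      (D.piLevelAut h𝒢 hconn j).ker)
    (fun i j h => (D.piPresentation h𝒢 T R).cosetGraphTrans_comp_proj
      (D.ker_piLevelAut_anti h𝒢 hconn h))
    (w ⟨j₀, le_rfl⟩).1
    (fun j => (D.piPresentation h𝒢 T R).vMk
      (D.piLevelAut h𝒢 hconn j).ker (w ⟨j₀, le_rfl⟩).1 1)
    (fun _ => rfl) (fun _ _ _ => rfl)
    (fun b₀ j => (D.piPresentation h𝒢 T R).bMk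
      (D.piLevelAut h𝒢 hconn j).ker b₀
      ((D.piPresentation h𝒢 T R).s b₀)⁻¹)
    (fun b₀ hb₀ => ⟨fun j => ⟨by rw [SemiGraph.SubgroupPresentation.cosetGraph_abuts_bMk _ _ b₀ _ hb₀,
      mul_inv_cancel], rfl⟩, fun _ _ _ => rfl⟩)
    (fun j x γ b₀ hx hγ hb => (D.piPresentation h𝒢 T R)
      |>.exists_arith_translate_vertex_branch hP _ (hN j) ι hιΦ hισ x γ b₀ hx hγ hb)
    ?_ j₀ w β β' hpair hcompat ?_ (decompositionDataOfChart Rc ι) (fun _ => rfl) (hVc _) ?_ ?_ ?_ ?_ hAcof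
    (eq_one_of_mem_arithVertGp_of_trivial_levels (D.chart h𝒢 hcof hcn hS hfin hne) _ hP ι hι hιconj hιΦ hισ hPH
      Rc hRcV (fun n => (D.piLevelAut h𝒢 hconn n).ker) (D.ker_piLevelAut_anti h𝒢 hconn) hN h37
      (D.isOpen_ker_piLevelAut h𝒢 hconn) hnobpNCpt aug haug j₀ w β β' hpair hcompat)
    C hC
  · -- (T2)
    intro j γ b₀ hγ hb
    obtain ⟨g, hg, h2⟩ := (D.piPresentation h𝒢 T R)
      |>.exists_mem_H_deck_translate_branch' _ γ b₀ hγ hb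
    refine ⟨ι g, fun i => ?_, ?_⟩
    · rw [SemiGraph.SubgroupPresentation.arithAct_eq_deckAct_of_inner _ hP _ (hN i) (hιΦ g) (hισ g)]
      exact SemiGraph.SubgroupPresentation.deckAct_vMk_one_of_mem_H _ _ _ hg
    · rw [SemiGraph.SubgroupPresentation.arithAct_eq_deckAct_of_inner _ hP _ (hN j) (hιΦ g) (hισ g)]
      exact h2
  · -- the base vertex of the given system
    intro i
    have h1 := (hcompat (show (⟨j₀, le_rfl⟩ : {i : ℕ // j₀ ≤ i}).1 ≤ i.1 from i.2)).1
    have h2 := congrArg (fun f : _ ⟶ 𝒢.graph => f.vertexMap (w i))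
      ((D.piPresentation h𝒢 T R).cosetGraphTrans_comp_proj
        (D.ker_piLevelAut_anti h𝒢 hconn
          (show (⟨j₀, le_rfl⟩ : {i : ℕ // j₀ ≤ i}).1 ≤ i.1 from i.2)))
    simp only [SemiGraph.comp_vertexMap, Function.comp_apply] at h2
    rw [h1] at h2
    exact h2.symm
  · -- `hωE`
    intro j e he
    exact exists_mem_arithVertGp_of_fixes_vMk (D.chart h𝒢 hcof hcn hS hfin hne) _ hP ι hιconj Rc hRcV _ (hN j) hιΦ hισ
      e he
  · -- `hωV`
    intro v hv j
    exact arithVertGp_fixes_vMk (D.chart h𝒢 hcof hcn hS hfin hne) _ hP ι hι hιconj hPH Rc hRcV _ (hN j) hιΦ hισ h37 hv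
  · -- `hκE'`
    intro b₀ hb₀ v hv hfix
    exact mem_arithBrGp_of_fixes_bMk (D.chart h𝒢 hcof hcn hS hfin hne) _ hP ι hι hιconj hPH Rc hRcV hRcB h37
      (fun n => (D.piLevelAut h𝒢 hconn n).ker) hN hb₀ hv hfix
      ((D.piPresentation h𝒢 T R).hsep_of_hfree_hMK
        (fun n => (D.projAut h𝒢 n).ker)
        (fun n => (D.piLevelAut h𝒢 hconn n).ker) hb₀
        (fun j x hx hxH => D.piPresentation_hfree h𝒢 hconn T R j _ 1 x hx
          (by rwa [one_mul, inv_one, mul_one]))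
        (D.piPresentation_hMK h𝒢 T R (𝒢.graph.edgeOf b₀)))
  · -- `hκV`
    intro b₀ hb₀ v hv j
    exact ⟨arithVertGp_fixes_vMk (D.chart h𝒢 hcof hcn hS hfin hne) _ hP ι hι hιconj hPH Rc hRcV _ (hN j) hιΦ hισ h37
        (arithBrGp_le_arithVertGp Rc ι hb₀ hv),
      arithBrGp_fixes_bMk (D.chart h𝒢 hcof hcn hS hfin hne) _ hP ι hι hιconj hιΦ hισ hPH hPM Rc hRcV hRcB
        (fun n => (D.piLevelAut h𝒢 hconn n).ker)
        (D.ker_piLevelAut_anti h𝒢 hconn) hN h37 hΦc hnobpNCpt hb₀ hv j⟩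


/-- **`stabBranchPairAug` PRODUCED at the outer model** `E := π₁^temp(𝒢) ⋊^out Π_A` of abc-iut-w4-d029's capstones
v3 `arithMaximalCompactStatementI/II_outerAction_piPresentation_chart` (their binder VERBATIM), from
`stabBranchPairAug_chart` (exactness: `outerAction_exact`; `hιconj`: `conj_toOuterSemidirectProduct`; `Φ_e`
continuous as a member of `contMulAut`).  Residual binders: `haugc`, `hLopen`, `hVc`, `hAcof`, `Π_A` compact
Hausdorff, `hRcV`/`hRcB`, and the capstone's own `hnobpNCpt`. [cite: MochizukiSemiAnbd2006, Thm 5.4 (i) p.66] -/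
theorem stabBranchPairAug_chart_outerAction (h37 : 𝒢.Thm37Hypotheses) [Finite 𝒢.graph.Vertex]
    [Finite 𝒢.graph.Branch] (T : ∀ w : 𝒢.graph.Vertex, D.PointSeq h𝒢 w)
    (R : SemiGraph.RefBranches 𝒢.graph) {PA : Type u} [Group PA] [TopologicalSpace PA] [IsTopologicalGroup PA]
    [CompactSpace PA] [T2Space PA]
    (ρ' : PA →* TopOut (D.chart h𝒢 hcof hcn hS hfin hne).G) (baseAct : PA →* Aut 𝒢.graph)
    [TopologicalSpace (outerSemidirectProduct ρ')] [IsTopologicalGroup (outerSemidirectProduct ρ')]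
    (hP : (D.piPresentation h𝒢 T R).IsArithCompatible
      (((contMulAut (D.chart h𝒢 hcof hcn hS hfin hne).G).subtype.comp
        (MonoidHom.fst (contMulAut (D.chart h𝒢 hcof hcn hS hfin hne).G) PA)).comp (outerSemidirectProduct ρ').subtype)
      (baseAct.comp (outerSemidirectProductSnd ρ')))
    (hN : ∀ (n : ℕ) (e : outerSemidirectProduct ρ') (x : (D.chart h𝒢 hcof hcn hS hfin hne).G),
      x ∈ (D.piLevelAut h𝒢 hconn n).ker →
        (((contMulAut (D.chart h𝒢 hcof hcn hS hfin hne).G).subtype.comp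
          (MonoidHom.fst (contMulAut (D.chart h𝒢 hcof hcn hS hfin hne).G) PA)).comp (outerSemidirectProduct ρ').subtype)
          e x ∈ (D.piLevelAut h𝒢 hconn n).ker)
    (haugc : Continuous (outerSemidirectProductSnd ρ'))
    (Rc : ChartRepresentatives (D.chart h𝒢 hcof hcn hS hfin hne))
    (hRcV : ∀ v, Rc.Hv v = (D.piPresentation h𝒢 T R).H v)
    (hRcB : ∀ b, Rc.Hb b = ((D.piPresentation h𝒢 T R).M (𝒢.graph.edgeOf b)).map
      (MulAut.conj ((D.piPresentation h𝒢 T R).s b)).toMonoidHom)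
    (hLopen : ∀ n, IsOpen (((D.piPresentation h𝒢 T R).arithAct hP
      (D.piLevelAut h𝒢 hconn n).ker (hN n)).ker : Set (outerSemidirectProduct ρ')))
    (hVc : ∀ v, IsCompact (((decompositionDataOfChart Rc (toOuterSemidirectProduct ρ')).vertGp v :
      Subgroup (outerSemidirectProduct ρ')) : Set (outerSemidirectProduct ρ')))
    (hAcof : ∀ U ∈ 𝓝 (1 : PA), ∃ j : ℕ, ∀ e ∈ ((D.piPresentation h𝒢 T R).arithAct
      hP (D.piLevelAut h𝒢 hconn j).ker (hN j)).ker,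
      outerSemidirectProductSnd ρ' e ∈ U)
    (hnobpNCpt : ∀ (C : Subgroup (D.chart h𝒢 hcof hcn hS hfin hne).G),
      IsCompact (C : Set (D.chart h𝒢 hcof hcn hS hfin hne).G) →
      ∀ (j₀ : ℕ) (w : ∀ i : {i : ℕ // j₀ ≤ i}, ((D.piPresentation h𝒢 T R).cosetGraph (D.piLevelAut h𝒢 hconn i.1).ker).Vertex)
      (β β' : ∀ i : {i : ℕ // j₀ ≤ i}, ((D.piPresentation h𝒢 T R).cosetGraph (D.piLevelAut h𝒢 hconn i.1).ker).Branch),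
      (∀ i, β i ≠ β' i ∧ ((D.piPresentation h𝒢 T R).cosetGraph (D.piLevelAut h𝒢 hconn i.1).ker).abuts (β i) = some (w i) ∧
        ((D.piPresentation h𝒢 T R).cosetGraph (D.piLevelAut h𝒢 hconn i.1).ker).abuts (β' i) = some (w i)) →
      (∀ ⦃i i' : {i : ℕ // j₀ ≤ i}⦄ (h : i.1 ≤ i'.1),
        ((D.piPresentation h𝒢 T R).cosetGraphTrans (D.ker_piLevelAut_anti h𝒢 hconn h)).vertexMap (w i') = w i ∧
        ((D.piPresentation h𝒢 T R).cosetGraphTrans (D.ker_piLevelAut_anti h𝒢 hconn h)).branchMap (β i') = β i ∧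
          ((D.piPresentation h𝒢 T R).cosetGraphTrans (D.ker_piLevelAut_anti h𝒢 hconn h)).branchMap (β' i') = β' i) →
      (∀ (i : {i : ℕ // j₀ ≤ i}) (γ : C),
        ((D.piPresentation h𝒢 T R).arithAct hP (D.piLevelAut h𝒢 hconn i.1).ker (hN i.1) ((toOuterSemidirectProduct ρ') γ)).hom.vertexMap (w i) = w i ∧
        ((D.piPresentation h𝒢 T R).arithAct hP (D.piLevelAut h𝒢 hconn i.1).ker (hN i.1) ((toOuterSemidirectProduct ρ') γ)).hom.branchMap (β i) = β i ∧
          ((D.piPresentation h𝒢 T R).arithAct hP (D.piLevelAut h𝒢 hconn i.1).ker (hN i.1) ((toOuterSemidirectProduct ρ') γ)).hom.branchMap (β' i) = β' i) →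
        C = ⊥) :
    ∀ (C : Subgroup (outerSemidirectProduct ρ')), IsCompact (C : Set (outerSemidirectProduct ρ')) →
      ∀ (j₀ : ℕ) (w : ∀ i : {i : ℕ // j₀ ≤ i},
        ((D.piPresentation h𝒢 T R).cosetGraph
          (D.piLevelAut h𝒢 hconn i.1).ker).Vertex)
      (β β' : ∀ i : {i : ℕ // j₀ ≤ i},
        ((D.piPresentation h𝒢 T R).cosetGraph
          (D.piLevelAut h𝒢 hconn i.1).ker).Branch),
      (∀ i, β i ≠ β' i ∧
        ((D.piPresentation h𝒢 T R).cosetGraph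
          (D.piLevelAut h𝒢 hconn i.1).ker).abuts (β i) = some (w i) ∧
        ((D.piPresentation h𝒢 T R).cosetGraph
          (D.piLevelAut h𝒢 hconn i.1).ker).abuts (β' i) = some (w i)) →
      (∀ ⦃i i' : {i : ℕ // j₀ ≤ i}⦄ (h : i.1 ≤ i'.1),
        ((D.piPresentation h𝒢 T R).cosetGraphTrans
            (D.ker_piLevelAut_anti h𝒢 hconn h)).vertexMap (w i') = w i ∧
        ((D.piPresentation h𝒢 T R).cosetGraphTrans
            (D.ker_piLevelAut_anti h𝒢 hconn h)).branchMap (β i') = β i ∧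
        ((D.piPresentation h𝒢 T R).cosetGraphTrans
            (D.ker_piLevelAut_anti h𝒢 hconn h)).branchMap (β' i') = β' i) →
      (∀ (i : {i : ℕ // j₀ ≤ i}) (g : outerSemidirectProduct ρ'), g ∈ C →
        ((D.piPresentation h𝒢 T R).arithAct hP
            (D.piLevelAut h𝒢 hconn i.1).ker (hN i.1) g).hom.vertexMap
            (w i) = w i ∧
        ((D.piPresentation h𝒢 T R).arithAct hP
            (D.piLevelAut h𝒢 hconn i.1).ker (hN i.1) g).hom.branchMap
            (β i) = β i ∧
        ((D.piPresentation h𝒢 T R).arithAct hP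
            (D.piLevelAut h𝒢 hconn i.1).ker (hN i.1) g).hom.branchMap
            (β' i) = β' i) →
      ∃ (v : 𝒢.graph.Vertex) (b b' : 𝒢.graph.Branch) (a : PA) (h : outerSemidirectProduct ρ'),
        (decompositionDataOfChart Rc (toOuterSemidirectProduct ρ')).abut b = some v ∧
        (decompositionDataOfChart Rc (toOuterSemidirectProduct ρ')).abut b' = some v ∧
        h ∈ (decompositionDataOfChart Rc (toOuterSemidirectProduct ρ')).vertGp v ∧
        (b' ≠ b ∨ h ∉ (decompositionDataOfChart Rc (toOuterSemidirectProduct ρ')).brGp b) ∧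
        C.map (outerSemidirectProductSnd ρ') ≤ conjSubgroup a
          (((decompositionDataOfChart Rc (toOuterSemidirectProduct ρ')).brGp b ⊓
            conjSubgroup h ((decompositionDataOfChart Rc (toOuterSemidirectProduct ρ')).brGp b')).map
            (outerSemidirectProductSnd ρ')) := by
  obtain ⟨hι, hex, -⟩ := outerAction_exact (D.chart h𝒢 hcof hcn hS hfin hne) ρ' h37.toProp36Hypotheses
  have hισ : ∀ g : (D.chart h𝒢 hcof hcn hS hfin hne).G,
      (baseAct.comp (outerSemidirectProductSnd ρ')) ((toOuterSemidirectProduct ρ') g) = 1 := fun g => by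
    have hg : (toOuterSemidirectProduct ρ') g ∈ (outerSemidirectProductSnd ρ').ker := hex ▸ ⟨g, rfl⟩
    rw [MonoidHom.comp_apply, (MonoidHom.mem_ker).mp hg, map_one]
  exact stabBranchPairAug_chart D h𝒢 hcof hcn hS hfin hne hconn h37 T R hP hN (toOuterSemidirectProduct ρ') hι (fun _ => rfl) hισ
    (fun e x => conj_toOuterSemidirectProduct ρ' e x) (fun e => e.1.1.2.1) (outerSemidirectProductSnd ρ') haugc
    hex.symm Rc hRcV hRcB hLopen hVc hAcof hnobpNCpt

end Chart

end ProfiniteSemiGraph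

end Literature.AnabelianGeometry.SemiGraphs
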